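import Summits.AnomalousDissipation.AnomalousDissipation.Theorems.MomentParityQuarticGateRowPoly
import Summits.AnomalousDissipation.AnomalousDissipation.Theorems.MomentParityQuarticGateRows
import Summits.AnomalousDissipation.AnomalousDissipation.Theorems.SmoothEulerCoerciveForce.Negative.Translate
import Literature.Analysis.FunctionSpaces.TorusHolderSobolevEmbedding

/-!
# Stub `stub_axialDefect` (S5a) of the line `axis-sectors` — helper I: shear translations
# (crux `MomentParity.QuarticGate`, stmt-AnomalousDissipation-11464)

Translation calculus on `T³` for the averaging argument of S5a (a shear-symmetric law only sees
axial quadratic Casimirs). For a translate `x ↦ h (x + a)` of a field on the torus: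

* the torus calculus (`Torus.fderiv`, `Torus.laplacian`, `Torus.divergence`, all defined through the
  re-centred lift) commutes with translations — the tree's
  `SmoothEulerCoerciveForce.Negative.{liftAt,fderiv,divergence}_comp_add_right` (landed, reused here);
* `band_comp_add_right` — translates of band tests are band tests (`IsSmooth.comp_add_right`,
  `isDivFree_comp_add_right`, `hasZeroMean_comp_add_right`, `Torus.mFourierCoeff_comp_add_right`);
* `integral_inner_comp_add_right` (and the `laplacian` / `fderiv` / invariant-force variants) —
  the pairings entering the row polynomial of `MomentParityQuarticGateRowPoly` are translation
  invariant (`MeasureTheory.integral_add_right_eq_self`);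
* `fourierTruncate_eq_sum_comp_add_right` — the translated family `b (· + a)` of an orthonormal band
  basis again reconstructs the truncation, `P_N u = Σᵢ (u, bᵢ(·+a)) bᵢ(·+a)`;
* `finite_shearTorsion` — the shear torsion group `H_L = {a | a 1 = 0, L • a = 0}` is finite.

All declarations live in the sub-namespace `MomentParityQuarticGate.AxialDefect` (the sibling stubs of
the line carry their own translation lemmas under other sub-namespaces).
-/

-- `Summit.<Summit>.<Problem>` is the tree's mandated summit-side namespace (CONVENTIONS §2); for this
-- single-conjunct summit the two coincide, so the duplicate is deliberate.
set_option linter.dupNamespace false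

namespace Summit.AnomalousDissipation.AnomalousDissipation.Theorems.MomentParityQuarticGate

open MeasureTheory Filter MvPolynomial
open scoped InnerProductSpace RealInnerProductSpace ENNReal
open Literature.Analysis.FunctionSpaces Literature.Analysis.FluidPDE
open Summit.AnomalousDissipation.AnomalousDissipation.Theses.MomentParity
open Summit.AnomalousDissipation.AnomalousDissipation.Theorems.QuarticGate.Negative
open Summit.AnomalousDissipation.AnomalousDissipation.Theorems.SmoothEulerCoerciveForce.Negative

namespace AxialDefect

variable {N n : ℕ} {b : Fin n → UnitAddTorus (Fin 3) → EuclideanSpace ℝ (Fin 3)}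

/-! ## Translates of band tests -/

/-- **Translates of band tests are band tests** (smoothness, solenoidality, zero mean and the
Fourier support `0 < |k|² ≤ N²` are translation invariant; `𝓕(h(·+a))(k) = e_k(a) ĥ(k)`).
[folklore] -/
theorem band_comp_add_right {h : UnitAddTorus (Fin 3) → EuclideanSpace ℝ (Fin 3)}
    (hh : Torus.IsSmooth h ∧ Torus.IsDivFree h ∧ Torus.HasZeroMean h ∧
      ∀ k ∉ (Torus.freqBall N).erase (0 : Fin 3 → ℤ),
        UnitAddTorus.mFourierCoeff (EuclideanSpace.complexify ∘ h) k = 0)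
    (a : UnitAddTorus (Fin 3)) :
    Torus.IsSmooth (fun x => h (x + a)) ∧ Torus.IsDivFree (fun x => h (x + a)) ∧
      Torus.HasZeroMean (fun x => h (x + a)) ∧
      ∀ k ∉ (Torus.freqBall N).erase (0 : Fin 3 → ℤ),
        UnitAddTorus.mFourierCoeff (EuclideanSpace.complexify ∘ fun x => h (x + a)) k = 0 := by
  refine ⟨hh.1.comp_add_right a, isDivFree_comp_add_right hh.2.1 a,
    hasZeroMean_comp_add_right hh.2.2.1 a, fun k hk => ?_⟩
  have hc : (EuclideanSpace.complexify ∘ fun x => h (x + a)) =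
      fun x => (EuclideanSpace.complexify ∘ h) (x + a) := rfl
  rw [hc, Torus.mFourierCoeff_comp_add_right, hh.2.2.2 k hk, smul_zero]

/-! ## Translation invariance of the pairings of the row polynomial -/

/-- `∫ ⟪h₁(y + a), h₂(y + a)⟫ dy = ∫ ⟪h₁, h₂⟫` (Haar invariance). [folklore] -/
theorem integral_inner_comp_add_right (h₁ h₂ : UnitAddTorus (Fin 3) → EuclideanSpace ℝ (Fin 3))
    (a : UnitAddTorus (Fin 3)) :
    ∫ y, ⟪h₁ (y + a), h₂ (y + a)⟫_ℝ = ∫ y, ⟪h₁ y, h₂ y⟫_ℝ :=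
  integral_add_right_eq_self (fun y => ⟪h₁ y, h₂ y⟫_ℝ) a

/-- `∫ ⟪f, h(· + a)⟫ = ∫ ⟪f, h⟫` for an `a`-invariant field `f`. [folklore] -/
theorem integral_inner_comp_add_right_of_invariant {f : UnitAddTorus (Fin 3) → EuclideanSpace ℝ (Fin 3)}
    {a : UnitAddTorus (Fin 3)} (hf : ∀ x, f (x + a) = f x)
    (h : UnitAddTorus (Fin 3) → EuclideanSpace ℝ (Fin 3)) :
    ∫ y, ⟪f y, h (y + a)⟫_ℝ = ∫ y, ⟪f y, h y⟫_ℝ := by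
  have h1 := integral_add_right_eq_self (μ := volume) (fun z => ⟪f z, h z⟫_ℝ) a
  simp only [hf] at h1
  exact h1

/-- `∫ ⟪h₁(· + a), Δ(h₂(· + a))⟫ = ∫ ⟪h₁, Δh₂⟫` (the Laplacian, defined through the re-centred lift,
commutes with translations). [folklore] -/
theorem integral_inner_laplacian_comp_add_right
    (h₁ h₂ : UnitAddTorus (Fin 3) → EuclideanSpace ℝ (Fin 3)) (a : UnitAddTorus (Fin 3)) :
    ∫ y, ⟪h₁ (y + a), Torus.laplacian (fun x => h₂ (x + a)) y⟫_ℝ =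
      ∫ y, ⟪h₁ y, Torus.laplacian h₂ y⟫_ℝ := by
  have hL : ∀ y, Torus.laplacian (fun x => h₂ (x + a)) y = Torus.laplacian h₂ (y + a) := fun y => by
    unfold Torus.laplacian
    rw [liftAt_comp_add_right]
  simp_rw [hL]
  exact integral_add_right_eq_self (fun y => ⟪h₁ y, Torus.laplacian h₂ y⟫_ℝ) a

/-- `∫ ⟪D(h₁(· + a)) (h₂(· + a)), h₃(· + a)⟫ = ∫ ⟪Dh₁ h₂, h₃⟫`. [folklore] -/
theorem integral_inner_fderiv_comp_add_right
    (h₁ h₂ h₃ : UnitAddTorus (Fin 3) → EuclideanSpace ℝ (Fin 3)) (a : UnitAddTorus (Fin 3)) :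
    ∫ y, ⟪Torus.fderiv (fun x => h₁ (x + a)) y (h₂ (y + a)), h₃ (y + a)⟫_ℝ =
      ∫ y, ⟪Torus.fderiv h₁ y (h₂ y), h₃ y⟫_ℝ := by
  simp_rw [SmoothEulerCoerciveForce.Negative.fderiv_comp_add_right]
  exact integral_add_right_eq_self (fun y => ⟪Torus.fderiv h₁ y (h₂ y), h₃ y⟫_ℝ) a

/-- The coefficient `∫ ⟪h₁(y + a + c), h₂(y + c)⟫ dy = ∫ ⟪h₁(y + a), h₂ y⟫ dy`. [folklore] -/
theorem integral_inner_comp_add_right_add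
    (h₁ h₂ : UnitAddTorus (Fin 3) → EuclideanSpace ℝ (Fin 3)) (a c : UnitAddTorus (Fin 3)) :
    ∫ y, ⟪h₁ (y + (a + c)), h₂ (y + c)⟫_ℝ = ∫ y, ⟪h₁ (y + a), h₂ y⟫_ℝ := by
  have h1 := integral_add_right_eq_self (μ := volume) (fun z => ⟪h₁ (z + a), h₂ z⟫_ℝ) c
  simp only [add_assoc, add_comm c a] at h1
  exact h1

/-! ## The finite shear torsion group -/

/-- **The shear torsion group `H_L = {a : T³ | a 1 = 0, L • a = 0}` is finite** (`L > 0`): it sits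
in the product of the `L`-torsion subgroups of the three circles (`AddCircle.finite_torsion`).
[folklore] -/
theorem finite_shearTorsion {L : ℕ} (hL : 0 < L) :
    {a : UnitAddTorus (Fin 3) | a 1 = 0 ∧ L • a = 0}.Finite := by
  refine (Set.Finite.pi (t := fun _ : Fin 3 => {x : UnitAddCircle | L • x = 0})
    fun _ => AddCircle.finite_torsion (1 : ℝ) hL).subset ?_
  rintro a ⟨-, ha⟩
  exact fun i _ => by simpa using congr_fun ha i

/-! ## The translated band basis reconstructs the truncation -/

/-- **Reconstruction in the translated basis.** If `P_N u = Σᵢ (u, bᵢ) bᵢ` on level-`N` fields for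
a family `b` of band tests, then also `P_N u = Σᵢ (u, bᵢ(· + a)) bᵢ(· + a)`: expand each `bⱼ`
in the translates (`bⱼ(· − a)` is a band test, `band_eq_sum_smul`) and each `(u, bᵢ(· + a))` in
the `bⱼ` (`pairing_band_eq_sum`); the two coefficient matrices agree by Haar invariance. [folklore] -/
theorem fourierTruncate_eq_sum_comp_add_right
    (hb : ∀ i, Torus.IsSmooth (b i) ∧ Torus.IsDivFree (b i) ∧ Torus.HasZeroMean (b i) ∧
      ∀ k ∉ (Torus.freqBall N).erase (0 : Fin 3 → ℤ),
        UnitAddTorus.mFourierCoeff (EuclideanSpace.complexify ∘ (b i)) k = 0)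
    (hbs : ∀ u : Torus.energySpace (Fin 3),
      (∀ k ∉ (Torus.freqBall N).erase (0 : Fin 3 → ℤ),
        UnitAddTorus.mFourierCoeff (EuclideanSpace.complexify ∘
          (u.1 : UnitAddTorus (Fin 3) → EuclideanSpace ℝ (Fin 3))) k = 0) →
      ∀ x, Torus.fourierTruncate N (u.1 : UnitAddTorus (Fin 3) → EuclideanSpace ℝ (Fin 3)) x =
        ∑ i, Torus.pairing u.1 (b i) • b i x)
    (a : UnitAddTorus (Fin 3)) :
    ∀ u : Torus.energySpace (Fin 3),
      (∀ k ∉ (Torus.freqBall N).erase (0 : Fin 3 → ℤ),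
        UnitAddTorus.mFourierCoeff (EuclideanSpace.complexify ∘
          (u.1 : UnitAddTorus (Fin 3) → EuclideanSpace ℝ (Fin 3))) k = 0) →
      ∀ x, Torus.fourierTruncate N (u.1 : UnitAddTorus (Fin 3) → EuclideanSpace ℝ (Fin 3)) x =
        ∑ i, Torus.pairing u.1 (fun y => b i (y + a)) • b i (x + a) := by
  intro u hu x
  have hband' : ∀ i, Torus.IsSmooth (fun y => b i (y + a)) ∧ Torus.IsDivFree (fun y => b i (y + a)) ∧
      Torus.HasZeroMean (fun y => b i (y + a)) ∧
      ∀ k ∉ (Torus.freqBall N).erase (0 : Fin 3 → ℤ),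
        UnitAddTorus.mFourierCoeff (EuclideanSpace.complexify ∘ fun y => b i (y + a)) k = 0 :=
    fun i => band_comp_add_right (hb i) a
  -- expansion of `b j` in the translated family
  have hexp : ∀ j, b j x = ∑ i, (∫ y, ⟪b j y, b i (y + a)⟫_ℝ) • b i (x + a) := by
    intro j
    have h1 := band_eq_sum_smul hbs (band_comp_add_right (hb j) (-a)) (x + a)
    rw [add_neg_cancel_right] at h1
    rw [h1]
    refine Finset.sum_congr rfl fun i _ => ?_
    congr 1
    have h2 := integral_add_right_eq_self (μ := volume) (fun y => ⟪b j (y + -a), b i y⟫_ℝ) a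
    simp only [add_neg_cancel_right] at h2
    exact h2.symm
  -- the translated pairings in the coordinates
  have hpair : ∀ i, Torus.pairing u.1 (fun y => b i (y + a)) =
      ∑ j, (∫ y, ⟪b j y, b i (y + a)⟫_ℝ) * Torus.pairing u.1 (b j) := by
    intro i
    rw [pairing_band_eq_sum hb hbs (hband' i) u]
    refine Finset.sum_congr rfl fun j _ => ?_
    rw [integral_congr_ae (ae_of_all _ fun y => real_inner_comm (b j y) (b i (y + a)))]
  rw [hbs u hu x]
  simp_rw [hpair, Finset.sum_smul, mul_smul]
  rw [Finset.sum_comm]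
  refine Finset.sum_congr rfl fun j _ => ?_
  rw [hexp j, Finset.smul_sum]
  exact Finset.sum_congr rfl fun i _ => smul_comm _ _ _

/-! ## Rows in a band basis: integrability, Casimirs, translation -/

/-- **Rows of polynomial tests over a band family are integrable** for a finite law with bounded
support carried by level-`N` fields (the row is a coordinate polynomial, `exists_rowPoly`). [folklore] -/
theorem integrable_row_of_bounded
    (hb : ∀ i, Torus.IsSmooth (b i) ∧ Torus.IsDivFree (b i) ∧ Torus.HasZeroMean (b i) ∧
      ∀ k ∉ (Torus.freqBall N).erase (0 : Fin 3 → ℤ),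
        UnitAddTorus.mFourierCoeff (EuclideanSpace.complexify ∘ (b i)) k = 0)
    (hbo : ∀ i j, ∫ x, ⟪b i x, b j x⟫_ℝ = if i = j then (1 : ℝ) else 0)
    (hbs : ∀ u : Torus.energySpace (Fin 3),
      (∀ k ∉ (Torus.freqBall N).erase (0 : Fin 3 → ℤ),
        UnitAddTorus.mFourierCoeff (EuclideanSpace.complexify ∘
          (u.1 : UnitAddTorus (Fin 3) → EuclideanSpace ℝ (Fin 3))) k = 0) →
      ∀ x, Torus.fourierTruncate N (u.1 : UnitAddTorus (Fin 3) → EuclideanSpace ℝ (Fin 3)) x =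
        ∑ i, Torus.pairing u.1 (b i) • b i x)
    (ν : ℝ) {f : UnitAddTorus (Fin 3) → EuclideanSpace ℝ (Fin 3)} (hf : Torus.IsSmooth f)
    (μ₀ : Measure (Torus.energySpace (Fin 3))) [IsFiniteMeasure μ₀] (hl₀ : ∀ᵐ u ∂μ₀, IsLevel N u)
    {R : ℝ} (hR : ∀ᵐ u ∂μ₀, ‖u‖ ≤ R) (P : MvPolynomial (Fin n) ℝ) :
    Integrable (fun u : Torus.energySpace (Fin 3) => Torus.nsGeneratorPairing ν f u (polyGrad b P u)) μ₀ := by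
  obtain ⟨Q, -, hQ, -⟩ := exists_rowPoly hb hbo hbs ν f hf n b hb P P.totalDegree le_rfl
  refine (integrable_eval_coords (fun i => (hb i).1.memLp 2) μ₀ hR Q).congr ?_
  exact hl₀.mono fun u hu => (hQ u hu).symm

/-- **A Casimir's Euler polynomial vanishes identically**: if `{p, B_N} = 0` on level-`N` fields
for the test `(b, P)`, the explicit Euler row polynomial of `euler_row_eq_eval` is zero at every
point of `ℝⁿ` (every coordinate vector is realised, `exists_level_of_coords`). [folklore] -/
theorem eval_eulerPoly_eq_zero
    (hb : ∀ i, Torus.IsSmooth (b i) ∧ Torus.IsDivFree (b i) ∧ Torus.HasZeroMean (b i) ∧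
      ∀ k ∉ (Torus.freqBall N).erase (0 : Fin 3 → ℤ),
        UnitAddTorus.mFourierCoeff (EuclideanSpace.complexify ∘ (b i)) k = 0)
    (hbo : ∀ i j, ∫ x, ⟪b i x, b j x⟫_ℝ = if i = j then (1 : ℝ) else 0)
    (hbs : ∀ u : Torus.energySpace (Fin 3),
      (∀ k ∉ (Torus.freqBall N).erase (0 : Fin 3 → ℤ),
        UnitAddTorus.mFourierCoeff (EuclideanSpace.complexify ∘
          (u.1 : UnitAddTorus (Fin 3) → EuclideanSpace ℝ (Fin 3))) k = 0) →
      ∀ x, Torus.fourierTruncate N (u.1 : UnitAddTorus (Fin 3) → EuclideanSpace ℝ (Fin 3)) x =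
        ∑ i, Torus.pairing u.1 (b i) • b i x)
    {P : MvPolynomial (Fin n) ℝ}
    (hC : ∀ u : Torus.energySpace (Fin 3), IsLevel N u →
      Torus.nsGeneratorPairing (d := Fin 3) 0 0 u (polyGrad b P u) = 0)
    (x : Fin n → ℝ) :
    MvPolynomial.eval x
      (∑ i, bind₁ (fun j => ∑ l, C (∫ y, ⟪b j y, b l y⟫_ℝ) * X l) (pderiv i P) *
        ∑ j, ∑ k, X j * (X k * C (∫ y, ⟪Torus.fderiv (b i) y (b j y), b k y⟫_ℝ))) = 0 := by
  obtain ⟨v, hv, hvx, -, -⟩ := exists_level_of_coords hb hbo x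
  rw [← hvx, ← euler_row_eq_eval hb hbs hb P v hv]
  exact hC v hv

/-- **Translates of Casimirs are Casimirs**: if `{p, B_N} = 0` on `V_N` for `(b, P)`, then also for
the translated test `(b(· + a), P)` — its Euler pairing is the SAME coordinate polynomial (Haar
invariance of its coefficients) evaluated at the translated coordinates. [folklore] -/
theorem euler_comp_add_right_eq_zero
    (hb : ∀ i, Torus.IsSmooth (b i) ∧ Torus.IsDivFree (b i) ∧ Torus.HasZeroMean (b i) ∧
      ∀ k ∉ (Torus.freqBall N).erase (0 : Fin 3 → ℤ),
        UnitAddTorus.mFourierCoeff (EuclideanSpace.complexify ∘ (b i)) k = 0)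
    (hbo : ∀ i j, ∫ x, ⟪b i x, b j x⟫_ℝ = if i = j then (1 : ℝ) else 0)
    (hbs : ∀ u : Torus.energySpace (Fin 3),
      (∀ k ∉ (Torus.freqBall N).erase (0 : Fin 3 → ℤ),
        UnitAddTorus.mFourierCoeff (EuclideanSpace.complexify ∘
          (u.1 : UnitAddTorus (Fin 3) → EuclideanSpace ℝ (Fin 3))) k = 0) →
      ∀ x, Torus.fourierTruncate N (u.1 : UnitAddTorus (Fin 3) → EuclideanSpace ℝ (Fin 3)) x =
        ∑ i, Torus.pairing u.1 (b i) • b i x)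
    {P : MvPolynomial (Fin n) ℝ}
    (hC : ∀ u : Torus.energySpace (Fin 3), IsLevel N u →
      Torus.nsGeneratorPairing (d := Fin 3) 0 0 u (polyGrad b P u) = 0)
    (a : UnitAddTorus (Fin 3)) (u : Torus.energySpace (Fin 3)) (hu : IsLevel N u) :
    Torus.nsGeneratorPairing (d := Fin 3) 0 0 u (polyGrad (fun i y => b i (y + a)) P u) = 0 := by
  have hb' : ∀ i, Torus.IsSmooth (fun y => b i (y + a)) ∧ Torus.IsDivFree (fun y => b i (y + a)) ∧
      Torus.HasZeroMean (fun y => b i (y + a)) ∧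
      ∀ k ∉ (Torus.freqBall N).erase (0 : Fin 3 → ℤ),
        UnitAddTorus.mFourierCoeff (EuclideanSpace.complexify ∘ fun y => b i (y + a)) k = 0 :=
    fun i => band_comp_add_right (hb i) a
  have h1 := euler_row_eq_eval hb' (fourierTruncate_eq_sum_comp_add_right hb hbs a) hb' P u hu
  simp_rw [integral_inner_comp_add_right, integral_inner_fderiv_comp_add_right] at h1
  unfold polyGrad
  rw [h1]
  exact eval_eulerPoly_eq_zero hb hbo hbs hC _

/-- **Row invariance under shear translations.** For an `a`-invariant force and a law `μ₀` carried
by level-`N` fields whose coordinate statistics are `a`-invariant in law, the row of the translated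
test `(b(· + a), P)` has the same mean as the row of `(b, P)`: both are the mean of the SAME
coordinate polynomial (the row polynomial of `row_eq_eval`, whose coefficients are translation
invariant) against equal push-forward laws. [folklore] -/
theorem integral_row_comp_add_right
    (hb : ∀ i, Torus.IsSmooth (b i) ∧ Torus.IsDivFree (b i) ∧ Torus.HasZeroMean (b i) ∧
      ∀ k ∉ (Torus.freqBall N).erase (0 : Fin 3 → ℤ),
        UnitAddTorus.mFourierCoeff (EuclideanSpace.complexify ∘ (b i)) k = 0)
    (hbs : ∀ u : Torus.energySpace (Fin 3),
      (∀ k ∉ (Torus.freqBall N).erase (0 : Fin 3 → ℤ),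
        UnitAddTorus.mFourierCoeff (EuclideanSpace.complexify ∘
          (u.1 : UnitAddTorus (Fin 3) → EuclideanSpace ℝ (Fin 3))) k = 0) →
      ∀ x, Torus.fourierTruncate N (u.1 : UnitAddTorus (Fin 3) → EuclideanSpace ℝ (Fin 3)) x =
        ∑ i, Torus.pairing u.1 (b i) • b i x)
    (ν : ℝ) {f : UnitAddTorus (Fin 3) → EuclideanSpace ℝ (Fin 3)} (hf : Torus.IsSmooth f)
    {a : UnitAddTorus (Fin 3)} (hfa : ∀ x, f (x + a) = f x)
    (μ₀ : Measure (Torus.energySpace (Fin 3))) (hl₀ : ∀ᵐ u ∂μ₀, IsLevel N u)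
    (hsym : Measure.map (fun u : Torus.energySpace (Fin 3) => fun i =>
        Torus.pairing u.1 (fun x => b i (x + a))) μ₀ =
      Measure.map (fun u : Torus.energySpace (Fin 3) => fun i => Torus.pairing u.1 (b i)) μ₀)
    (P : MvPolynomial (Fin n) ℝ) :
    ∫ u, Torus.nsGeneratorPairing ν f u (polyGrad (fun i y => b i (y + a)) P u) ∂μ₀ =
      ∫ u, Torus.nsGeneratorPairing ν f u (polyGrad b P u) ∂μ₀ := by
  have hb' : ∀ i, Torus.IsSmooth (fun y => b i (y + a)) ∧ Torus.IsDivFree (fun y => b i (y + a)) ∧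
      Torus.HasZeroMean (fun y => b i (y + a)) ∧
      ∀ k ∉ (Torus.freqBall N).erase (0 : Fin 3 → ℤ),
        UnitAddTorus.mFourierCoeff (EuclideanSpace.complexify ∘ fun y => b i (y + a)) k = 0 :=
    fun i => band_comp_add_right (hb i) a
  have hbs' := fourierTruncate_eq_sum_comp_add_right hb hbs a
  set Q : MvPolynomial (Fin n) ℝ :=
    ∑ i, bind₁ (fun j => ∑ l, C (∫ y, ⟪b j y, b l y⟫_ℝ) * X l) (pderiv i P) *
      (C (∫ y, ⟪f y, b i y⟫_ℝ) + C ν * ∑ j, X j * C (∫ y, ⟪b j y, Torus.laplacian (b i) y⟫_ℝ) +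
        ∑ j, ∑ k, X j * (X k * C (∫ y, ⟪Torus.fderiv (b i) y (b j y), b k y⟫_ℝ))) with hQ
  have h1 : ∀ u : Torus.energySpace (Fin 3), IsLevel N u →
      Torus.nsGeneratorPairing ν f u (polyGrad (fun i y => b i (y + a)) P u) =
        MvPolynomial.eval (fun i => Torus.pairing u.1 (fun y => b i (y + a))) Q := by
    intro u hu
    have h := row_eq_eval hb' hbs' ν hf hb' P u hu
    simp_rw [integral_inner_comp_add_right, integral_inner_comp_add_right_of_invariant hfa,
      integral_inner_laplacian_comp_add_right, integral_inner_fderiv_comp_add_right] at h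
    exact h
  have h2 : ∀ u : Torus.energySpace (Fin 3), IsLevel N u →
      Torus.nsGeneratorPairing ν f u (polyGrad b P u) =
        MvPolynomial.eval (fun i => Torus.pairing u.1 (b i)) Q := fun u hu =>
    row_eq_eval hb hbs ν hf hb P u hu
  rw [integral_congr_ae (hl₀.mono h1), integral_congr_ae (hl₀.mono h2)]
  have e1 := integral_map (μ := μ₀)
    (φ := fun u : Torus.energySpace (Fin 3) => fun i => Torus.pairing u.1 (fun y => b i (y + a)))
    (f := fun z => MvPolynomial.eval z Q) (continuous_coords hb').aemeasurable
    (MvPolynomial.continuous_eval Q).aestronglyMeasurable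
  have e2 := integral_map (μ := μ₀)
    (φ := fun u : Torus.energySpace (Fin 3) => fun i => Torus.pairing u.1 (b i))
    (f := fun z => MvPolynomial.eval z Q) (continuous_coords hb).aemeasurable
    (MvPolynomial.continuous_eval Q).aestronglyMeasurable
  rw [← e1, ← e2, hsym]

end AxialDefect

/-! ## Registered sub-goal -/

/-- **Row invariance under shear translations** (registered sub-goal `axialDefect_rowInvariance` of
stmt-AnomalousDissipation-11464: `AxialDefect.integral_row_comp_add_right` in `∀`-form). For an
`a`-invariant smooth force and a law carried by level-`N` fields whose band coordinates are
`a`-invariant in law, the translated test `(b(· + a), P)` and the test `(b, P)` have the same mean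
row. [folklore] -/
theorem axialDefect_rowInvariance :
    ∀ {N n : ℕ} {b : Fin n → UnitAddTorus (Fin 3) → EuclideanSpace ℝ (Fin 3)}, (∀ i, Torus.IsSmooth
      (b i) ∧ Torus.IsDivFree (b i) ∧ Torus.HasZeroMean (b i) ∧ ∀ k ∉ (Torus.freqBall N).erase (0 :
      Fin 3 → ℤ), UnitAddTorus.mFourierCoeff (EuclideanSpace.complexify ∘ (b i)) k = 0) → (∀ u :
      Torus.energySpace (Fin 3), (∀ k ∉ (Torus.freqBall N).erase (0 : Fin 3 → ℤ),
      UnitAddTorus.mFourierCoeff (EuclideanSpace.complexify ∘ (u.1 : UnitAddTorus (Fin 3) →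
      EuclideanSpace ℝ (Fin 3))) k = 0) → ∀ x, Torus.fourierTruncate N (u.1 : UnitAddTorus (Fin 3) →
      EuclideanSpace ℝ (Fin 3)) x = ∑ i, Torus.pairing u.1 (b i) • b i x) → ∀ (ν : ℝ) (f :
      UnitAddTorus (Fin 3) → EuclideanSpace ℝ (Fin 3)), Torus.IsSmooth f → ∀ (a : UnitAddTorus (Fin
      3)), (∀ x, f (x + a) = f x) → ∀ (μ₀ : Measure (Torus.energySpace (Fin 3))), (∀ᵐ u ∂μ₀, IsLevel N
      u) → Measure.map (fun u : Torus.energySpace (Fin 3) => fun i => Torus.pairing u.1 (fun x => b i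
      (x + a))) μ₀ = Measure.map (fun u : Torus.energySpace (Fin 3) => fun i => Torus.pairing u.1 (b
      i)) μ₀ → ∀ P : MvPolynomial (Fin n) ℝ, ∫ u, Torus.nsGeneratorPairing ν f u (polyGrad (fun i y =>
      b i (y + a)) P u) ∂μ₀ = ∫ u, Torus.nsGeneratorPairing ν f u (polyGrad b P u) ∂μ₀ :=
  fun hb hbs ν _ hf _ hfa μ₀ hl₀ hsym P =>
    AxialDefect.integral_row_comp_add_right hb hbs ν hf hfa μ₀ hl₀ hsym P

end Summit.AnomalousDissipation.AnomalousDissipation.Theorems.MomentParityQuarticGate
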